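import Mathlib
import HarnessLib
import Summits.ResolutionOfSingularities.ResolutionOfSingularities.Theorems.WildQuotientsWildQuotientResolutionS1aA1Move2
import Summits.ResolutionOfSingularities.ResolutionOfSingularities.Theorems.WildQuotientsWildQuotientResolutionS1aD4Move2Ring
import Summits.ResolutionOfSingularities.ResolutionOfSingularities.Theorems.WildQuotientsWildQuotientResolutionS1aD4Move2Cover

/-!
# S1a — INSTANCE I-3 (D₄): MOVE 2 OF MT-D₄ (v1.1) over an ABSTRACT model of the node of `N(x₁)` (re-coordinated), with the exposed node of the residual chart `[z′]`

[OURS · L1 W4.5c · lead-1 g13; plan-1 RULING R-F15e (I-3 move-by-move in the I-2 architecture), X-CERT v1.1 §2 / v1.2-D4ROWS move 2 «centre (z:1, X₀′:1);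
[X₀′] KILLED (J̃(s₁) = 1/s₁), [z] RESIDUAL core (X₀″, x₂)», NOTES `D4 TREE OF RECORD`; pattern of ✓`…S1aA1Move2` / ✓`…S1aD4Move3`] — NOT statements of the manuscript;
counted 0; AI-level work, weaker than expert review. Crux stmt-ResolutionOfSingularities-17941 `CyclicQuotientFourfolds`, line `s1a-logminvertex` v13 (`stub_reachLowerInFX`).

* ★★★ `GameFrame.GModel.d4_move2` — `M₁` a separated model (the realisation of move 1), `W` a stable affine chart (`N(x₁)`) with node `DW` modelled by `Φ : DW.B ≃+* P`
  (`τ = Φ⁻¹σΦ` with the move-2 rows of ✓`…S1aD4Move2Ring` in the RE-COORDINATED model, `z = x₂ − sX₁` FIXED: `τX₁ = X₁ + X₀s`, `τx₃ = x₃ − sX₁z(z + sX₁)`; `s, X₀, z`,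
  the inverted norm `ηinv` (inverse `η`) and `Gfix` fixed; K1′ for `(z, X₀)` and the degrees as HYPOTHESES), an atlas `𝔄₁` with `F ⊆ W`, and a closedness family
  `(Uᵢ, uᵢ)`: then `(z:1, X₀:1)` is an ADMISSIBLE move and EVERY realisation `π₂ : M₂ → M₁` carries an atlas `𝔄₂` with `F_𝔄₂ ⊆ W₂ = [z]` (the `[X₀]` chart is
  KILLED: `Y = X₀T ∈ 𝔞₂` by ✓`d4m2_residual_mem`, so its cover element `c₁ = Y^{2dpd₂}·ηinv^{2d₂} ∈ 𝔞₂`), together with the EXPOSED NODE of `W₂ = [z]`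
  (iso, tameness, intertwining, chart-transition pin, the cover `M₂ = W₂ ∪ W₂′ ∪ π₂⁻¹(⋃ Uᵢ)` and the ratio section `u₂ = c₁/c₀`, a unit on `W₂ ∩ W₂′`).
-/

set_option linter.dupNamespace false

noncomputable section

open CategoryTheory Limits AlgebraicGeometry TopologicalSpace Topology Opposite
open Literature.AlgebraicGeometry.Resolution Literature.AlgebraicGeometry.RelativeSpec
open scoped LaurentPolynomial
open Summit.ResolutionOfSingularities.ResolutionOfSingularities.Theorems.WildQuotientResolution.S1
open Summit.ResolutionOfSingularities.ResolutionOfSingularities.Theorems.WildQuotientResolution.S1.NodeAtlas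
open Summit.ResolutionOfSingularities.ResolutionOfSingularities.Theorems.WildQuotientResolution.S1.CoarseChart
open Summit.ResolutionOfSingularities.ResolutionOfSingularities.Theorems.WildQuotientResolution.S1.ProducerStep
open Summit.ResolutionOfSingularities.ResolutionOfSingularities.Theorems.WildQuotientResolution.S1.NpFrame
open Summit.ResolutionOfSingularities.ResolutionOfSingularities.Theorems.WildQuotientResolution.S1.GoodCharts
open Summit.ResolutionOfSingularities.ResolutionOfSingularities.Theorems.WildQuotientResolution.S1.BlowupCharts
open Summit.ResolutionOfSingularities.ResolutionOfSingularities.Theorems.WildQuotientResolution.S1.KillableTransport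
open Summit.ResolutionOfSingularities.ResolutionOfSingularities.Theorems.WildQuotientResolution.S1.KillCert
open Summit.ResolutionOfSingularities.ResolutionOfSingularities.Theorems.WildQuotientResolution.S1.ReesBigrading
open Summit.ResolutionOfSingularities.ResolutionOfSingularities.Theorems.WildQuotientResolution.S1.NodeTransport
open Summit.ResolutionOfSingularities.ResolutionOfSingularities.Theorems.WildQuotientResolution.S1.CobordantTransport
open Summit.ResolutionOfSingularities.ResolutionOfSingularities.Theorems.WildQuotientResolution.BlowupExit
open Summit.ResolutionOfSingularities.ResolutionOfSingularities.Theorems.WildQuotientResolution.S1.KillGlue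

/-! ## Move 2 of MT-a1″ -/

namespace Summit.ResolutionOfSingularities.ResolutionOfSingularities.Theorems.WildQuotientResolution.S1.GameFrame.GModel

open MvPolynomial

variable {p : ℕ} {X' X₁ : Scheme.{0}} {q : X' ⟶ X₁} {G : Type} [Group G] {ρ : G →* Aut X'} {g₀ : G}

set_option maxHeartbeats 1600000 in
/-- ★★★ **MOVE 2 OF MT-D₄ (abstract model of the node of `N(x₁)`, re-coordinated), with the exposed node of the residual chart `[z′]`.** See the module
docstring. [OURS · L1 W4.5c · R-F15e I-3, move 2 of 4; NOT a statement of the manuscript] -/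
theorem d4_move2 [Finite G] [NeZero p] (hp : p.Prime) (hG : ∀ g : G, g ∈ Subgroup.zpowers g₀)
    (M₁ : GModel p q G ρ g₀) [M₁.V.IsSeparated] (W : M₁.act.StableAffineOpens) (DW : NodeData p M₁.act g₀ W)
    {P : Type} [CommRing P] [CharP P p] (Φ : letI := DW.instCommRing; DW.B ≃+* P) (τ : P ≃+* P)
    (hτ : letI := DW.instCommRing; ∀ x : P, τ x = Φ (DW.σ (Φ.symm x)))
    -- generators of the model, the inverted norm, and the rows of `τ`
    (s X₀ X₁ z x₃ η ηinv : P) (Gfix : Set P)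
    (hs : τ s = s) (hX₀ : τ X₀ = X₀) (hX₁ : τ X₁ = X₁ + X₀ * s) (hz : τ z = z) (hx₃ : τ x₃ = x₃ - s * X₁ * z * (z + s * X₁))
    (hηinv : τ ηinv = ηinv) (hηη : η * ηinv = 1)
    (hfix : ∀ g ∈ Gfix, τ g = g) (hgen : Subring.closure (({s, X₀, X₁, z, x₃} : Set P) ∪ Gfix) = ⊤)
    -- degrees in the transported grading
    (θ : Π j : Fin DW.m, ZMod (DW.r j)) (d : ℕ) (hd : 0 < d)
    (hzd : letI := DW.instCommRing; letI := DW.instGradedRing; z ∈ mapGrading DW.𝒜 Φ 0)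
    (hX₀d : letI := DW.instCommRing; letI := DW.instGradedRing; X₀ ∈ mapGrading DW.𝒜 Φ (2 • θ))
    (hηinvd : letI := DW.instCommRing; letI := DW.instGradedRing; ηinv ∈ mapGrading DW.𝒜 Φ (-((d * (2 * p)) • θ)))
    -- K1′ for the centre `(z, X₀)`
    (hK1 : RingTheory.Sequence.IsRegular P (List.ofFn (![z, X₀] : Fin 2 → P)))
    (hK1' : IsRegularRing (P ⧸ Ideal.span (Set.range (![z, X₀] : Fin 2 → P))))
    -- the closedness datum on `M₁`: a cover and separating sections with values in the filtration
    {ι : Type} (U : ι → M₁.V.Opens) (hcov : ∀ x : M₁.V, x ∈ W.1 ∨ ∃ i, x ∈ U i) (u : ι → Γ(M₁.V, W.1)) (nu : ι → ℕ) (hnu : ∀ i, 0 < nu i)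
    (hu : letI := DW.instCommRing; letI := DW.instGradedRing; ∀ i,
      Φ ((DW.e (u i) : ↥(DW.𝒜 0)) : DW.B) ∈ (weightedFiltration (![z, X₀] : Fin 2 → P) ![1, 1]).ideal (nu i))
    (huU : ∀ i, ∀ v ∈ W.1, v ∈ U i → v ∈ M₁.V.basicOpen (u i))
    (𝔄₁ : NodeAtlasData p M₁.act g₀) (hF₁ : 𝔄₁.fLocus ⊆ (W.1 : Set M₁.V)) :
    letI := DW.instCommRing; letI := DW.instGradedRing; letI := mapGradedRing DW.𝒜 Φ
    ∃ (𝒦₂ : ReesFiltration M₁.V) (d₂ : ℕ), 0 < d₂ ∧ IsAdmissibleCentre p M₁.act g₀ 𝒦₂ d₂ ∧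
      ∀ (M₂ : GModel p q G ρ g₀) (π₂ : M₂.V ⟶ M₁.V), IsBlowup π₂ (𝒦₂.ideal d₂) → M₂.r = π₂ ≫ M₁.r →
        (∀ g : G, (M₂.act.aut g).hom ≫ π₂ = π₂ ≫ (M₁.act.aut g).hom) →
        ∃ (W₂ : M₂.act.StableAffineOpens) (𝔄₂ : NodeAtlasData p M₂.act g₀) (_ : 𝔄₂.fLocus ⊆ (W₂.1 : Set M₂.V))
          (_ : IsAffineOpen W₂.1) (hle : W₂.1 ≤ π₂ ⁻¹ᵁ W.1)
          -- the exposed node of `W₂ = [z]`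
          (hf₂ : ∀ i, (![z, X₀] : Fin 2 → P) i ∈ mapGrading DW.𝒜 Φ ((![0, 2 • θ] : Fin 2 → Π j : Fin DW.m, ZMod (DW.r j)) i))
          (hσJ₂ : ∀ n : ℕ, ((weightedFiltration (![z, X₀] : Fin 2 → P) ![1, 1]).ideal n).map (τ : P →+* P) ≤
            (weightedFiltration (![z, X₀] : Fin 2 → P) ![1, 1]).ideal n)
          (hσp : ∀ x : P, (⇑τ)^[p] x = x)
          (y₀ : ↥(mapGrading DW.𝒜 Φ 0)) (_ : (y₀ : P) = z ^ (d₂ * (d * (2 * p))))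
          (hy₀ : y₀ ∈ (traceFiltration (mapGrading DW.𝒜 Φ) (![z, X₀] : Fin 2 → P) ![1, 1]).ideal (d₂ * (d * (2 * p))))
          (hσy₀ : τ (y₀ : P) = y₀)
          (c₁ : ↥(cobordantAlgebra (![z, X₀] : Fin 2 → P) ![1, 1]))
          (_ : (c₁ : P[T;T⁻¹]) = LaurentPolynomial.C ((X₀ ^ (d * p) * ηinv) ^ (2 * d₂)) * LaurentPolynomial.T (((d₂ * (d * (2 * p)) : ℕ)) : ℤ))
          (E₂ : letI := chartNodeGradedRing DW.r (mapGrading DW.𝒜 Φ) (![z, X₀] : Fin 2 → P) ![1, 1] hf₂ (d₂ * (d * (2 * p))) y₀ hy₀;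
            Γ(M₂.V, W₂.1) ≃+* ↥(chartNodeGrading DW.r (mapGrading DW.𝒜 Φ) (![z, X₀] : Fin 2 → P) ![1, 1] hf₂ (d₂ * (d * (2 * p))) y₀ hy₀ 0))
          (W₂' : M₂.V.Opens) (u₂ : Γ(M₂.V, W₂.1)),
          letI := chartNodeGradedRing DW.r (mapGrading DW.𝒜 Φ) (![z, X₀] : Fin 2 → P) ![1, 1] hf₂ (d₂ * (d * (2 * p))) y₀ hy₀
          IsTameNode p (ChartRing (mapGrading DW.𝒜 Φ) (![z, X₀] : Fin 2 → P) ![1, 1] (d₂ * (d * (2 * p))) y₀ hy₀)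
              (chartNodeGrading DW.r (mapGrading DW.𝒜 Φ) (![z, X₀] : Fin 2 → P) ![1, 1] hf₂ (d₂ * (d * (2 * p))) y₀ hy₀)
              (sigmaChart (mapGrading DW.𝒜 Φ) (![z, X₀] : Fin 2 → P) ![1, 1] (d₂ * (d * (2 * p))) y₀ hy₀ τ hσJ₂ hp.pos hσp hσy₀) ∧
            (∀ t' : Γ(M₂.V, W₂.1),
              ((E₂ ((M₂.act.aut g₀⁻¹).hom.appLE W₂.1 W₂.1 (W₂.2.1 g₀⁻¹).ge t') :
                  ↥(chartNodeGrading DW.r (mapGrading DW.𝒜 Φ) (![z, X₀] : Fin 2 → P) ![1, 1] hf₂ (d₂ * (d * (2 * p))) y₀ hy₀ 0)) :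
                  ChartRing (mapGrading DW.𝒜 Φ) (![z, X₀] : Fin 2 → P) ![1, 1] (d₂ * (d * (2 * p))) y₀ hy₀) =
                sigmaChart (mapGrading DW.𝒜 Φ) (![z, X₀] : Fin 2 → P) ![1, 1] (d₂ * (d * (2 * p))) y₀ hy₀ τ hσJ₂ hp.pos hσp hσy₀
                  ((E₂ t' : ↥(chartNodeGrading DW.r (mapGrading DW.𝒜 Φ) (![z, X₀] : Fin 2 → P) ![1, 1] hf₂ (d₂ * (d * (2 * p))) y₀ hy₀ 0)) :
                    ChartRing (mapGrading DW.𝒜 Φ) (![z, X₀] : Fin 2 → P) ![1, 1] (d₂ * (d * (2 * p))) y₀ hy₀)) ∧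
            (∀ x : Γ(M₁.V, W.1),
              ((E₂ (π₂.appLE W.1 W₂.1 hle x) :
                  ↥(chartNodeGrading DW.r (mapGrading DW.𝒜 Φ) (![z, X₀] : Fin 2 → P) ![1, 1] hf₂ (d₂ * (d * (2 * p))) y₀ hy₀ 0)) :
                  ChartRing (mapGrading DW.𝒜 Φ) (![z, X₀] : Fin 2 → P) ![1, 1] (d₂ * (d * (2 * p))) y₀ hy₀) =
                toChartRing (mapGrading DW.𝒜 Φ) (![z, X₀] : Fin 2 → P) ![1, 1] (d₂ * (d * (2 * p))) y₀ hy₀ ((DW.e.trans (zeroRingEquiv DW.𝒜 Φ)) x)) ∧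
            (∀ x : M₂.V, x ∈ W₂.1 ∨ x ∈ W₂' ∨ ∃ i, π₂.base x ∈ U i) ∧
            ((E₂ u₂ : ↥(chartNodeGrading DW.r (mapGrading DW.𝒜 Φ) (![z, X₀] : Fin 2 → P) ![1, 1] hf₂ (d₂ * (d * (2 * p))) y₀ hy₀ 0)) :
                ChartRing (mapGrading DW.𝒜 Φ) (![z, X₀] : Fin 2 → P) ![1, 1] (d₂ * (d * (2 * p))) y₀ hy₀) =
              algebraMap _ (ChartRing (mapGrading DW.𝒜 Φ) (![z, X₀] : Fin 2 → P) ![1, 1] (d₂ * (d * (2 * p))) y₀ hy₀) c₁ *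
                IsLocalization.Away.invSelf (coverElement (mapGrading DW.𝒜 Φ) (![z, X₀] : Fin 2 → P) ![1, 1] (d₂ * (d * (2 * p))) y₀ hy₀) ∧
            (∀ v ∈ W₂.1, v ∈ W₂' → v ∈ M₂.V.basicOpen u₂) := by
  classical
  letI := DW.instCommRing
  letI := DW.instGradedRing
  letI := mapGradedRing DW.𝒜 Φ
  have hp1 : p ≠ 1 := hp.one_lt.ne'
  have hdp : 0 < d * p := Nat.mul_pos hd hp.pos
  have hdbar : 0 < d * (2 * p) := Nat.mul_pos hd (Nat.mul_pos two_pos hp.pos)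
  have hw' : ∀ i, 0 < (![1, 1] : Fin 2 → ℕ) i := fun i => by fin_cases i <;> norm_num
  -- the transported node, read through `τ`
  have hτeq : (conj Φ DW.σ : P ≃+* P) = τ := RingEquiv.ext fun x => (hτ x).symm
  have htameτ : IsTameNode p P (mapGrading DW.𝒜 Φ) τ := hτeq ▸ isTameNode_map DW.𝒜 Φ p DW.σ DW.tame
  have hσp : ∀ x : P, (⇑τ)^[p] x = x := htameτ.2.2.2.2.2
  have hσL : ∀ t' : Γ(M₁.V, W.1), (((DW.e.trans (zeroRingEquiv DW.𝒜 Φ)) ((M₁.act.aut g₀⁻¹).hom.appLE W.1 W.1 (W.2.1 g₀⁻¹).ge t') :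
      ↥(mapGrading DW.𝒜 Φ 0)) : P) = τ (((DW.e.trans (zeroRingEquiv DW.𝒜 Φ)) t' : ↥(mapGrading DW.𝒜 Φ 0)) : P) := fun t' => by
    change Φ ((DW.e (actO M₁.act W g₀ t') : ↥(DW.𝒜 0)) : DW.B) = τ (Φ ((DW.e t' : ↥(DW.𝒜 0)) : DW.B))
    rw [DW.intertwine t', hτ, Φ.symm_apply_apply]
  have hf₂ := D4.d4m2_hf z X₀ DW.r (mapGrading DW.𝒜 Φ) θ hzd hX₀d
  have hσJ₂ := D4.d4m2_map_le τ s X₀ X₁ z x₃ Gfix hs hX₀ hX₁ hz hx₃ hfix hgen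
  have hσJc : ∀ n : ℕ, ((weightedFiltration (![z, X₀] : Fin 2 → P) ![1, 1]).ideal n).map (conj Φ DW.σ : P →+* P) ≤
      (weightedFiltration (![z, X₀] : Fin 2 → P) ![1, 1]).ideal n := by rw [hτeq]; exact hσJ₂
  -- closedness of the traces from the separating sections
  have hcl₂ : ∀ n : ℕ, 0 < n →
      closure (M₁.V.zeroLocus (U := W.1)
          ((((traceFiltration (mapGrading DW.𝒜 Φ) (![z, X₀] : Fin 2 → P) ![1, 1]).ideal n).comap
              ((DW.e.trans (zeroRingEquiv DW.𝒜 Φ) : Γ(M₁.V, W.1) ≃+* ↥(mapGrading DW.𝒜 Φ 0)) : Γ(M₁.V, W.1) →+* ↥(mapGrading DW.𝒜 Φ 0)) :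
            Ideal Γ(M₁.V, W.1)) : Set Γ(M₁.V, W.1)) ∩ (W.1 : Set M₁.V)) ⊆ (W.1 : Set M₁.V) := by
    intro n hn
    refine closure_zeroLocus_inter_subset_of_cover W.1 U hcov _ u (fun i => ⟨n, hn, ?_⟩) huU
    change (DW.e.trans (zeroRingEquiv DW.𝒜 Φ)) (u i ^ n) ∈ (traceFiltration (mapGrading DW.𝒜 Φ) (![z, X₀] : Fin 2 → P) ![1, 1]).ideal n
    rw [mem_traceFiltration_iff, map_pow, SetLike.GradeZero.coe_pow]
    change (Φ ((DW.e (u i) : ↥(DW.𝒜 0)) : DW.B)) ^ n ∈ _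
    have h := Ideal.pow_mem_pow (hu i) n
    have hle := Veronese.idealFiltration_pow_le (weightedFiltration (![z, X₀] : Fin 2 → P) ![1, 1]) (nu i) n
    exact (weightedFiltration (![z, X₀] : Fin 2 → P) ![1, 1]).antitone (Nat.le_mul_of_pos_left n (hnu i)) (hle h)
  -- ### the centre of move 2
  obtain ⟨𝒦₂, d₂, hd₂, hadm₂, -, hG𝒦₂, h𝒦₂O, hver₂, hsupp₂⟩ := exists_isAdmissibleCentre_of_node hG M₁ W DW Φ two_pos (![z, X₀] : Fin 2 → P)
    (![0, 2 • θ]) ![1, 1] hw' hf₂ hK1 hK1' hσJc hcl₂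
  refine ⟨𝒦₂, d₂, hd₂, hadm₂, fun M₂ π₂ hbl₂ hr₂ hcomm₂ => ?_⟩
  -- ### the realisation `M₂`: cover, (H1), residual, atlas
  have hdeg0 : z ^ (d₂ * (d * (2 * p))) ∈ mapGrading DW.𝒜 Φ 0 := D4.d4m2_cover_zero_deg z d d₂ DW.r (mapGrading DW.𝒜 Φ) hzd
  have hdeg1 : (X₀ ^ (d * p) * ηinv) ^ (2 * d₂) ∈ mapGrading DW.𝒜 Φ 0 := D4.d4m2_cover_one_deg X₀ ηinv d d₂ DW.r (mapGrading DW.𝒜 Φ) θ hX₀d hηinvd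
  obtain ⟨y', hy'0, hy'1⟩ : ∃ y' : Fin 2 → ↥(mapGrading DW.𝒜 Φ 0), y' 0 = ⟨_, hdeg0⟩ ∧ y' 1 = ⟨_, hdeg1⟩ := ⟨![⟨_, hdeg0⟩, ⟨_, hdeg1⟩], rfl, rfl⟩
  have hy'v0 : ((y' 0 : ↥(mapGrading DW.𝒜 Φ 0)) : P) = z ^ (d₂ * (d * (2 * p))) := congrArg Subtype.val hy'0
  have hy'v1 : ((y' 1 : ↥(mapGrading DW.𝒜 Φ 0)) : P) = (X₀ ^ (d * p) * ηinv) ^ (2 * d₂) := congrArg Subtype.val hy'1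
  have hy' : ∀ j, y' j ∈ (traceFiltration (mapGrading DW.𝒜 Φ) (![z, X₀] : Fin 2 → P) ![1, 1]).ideal (d₂ * (d * (2 * p))) := by
    intro j
    rw [mem_traceFiltration_iff]
    fin_cases j
    · exact (congrArg (fun x : P => x ∈ (weightedFiltration (![z, X₀] : Fin 2 → P) ![1, 1]).ideal (d₂ * (d * (2 * p)))) hy'v0).mpr
        (D4.d4m2_cover_zero_mem z X₀ d d₂)
    · exact (congrArg (fun x : P => x ∈ (weightedFiltration (![z, X₀] : Fin 2 → P) ![1, 1]).ideal (d₂ * (d * (2 * p)))) hy'v1).mpr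
        (D4.d4m2_cover_one_mem z X₀ ηinv d d₂)
  have hσy' : ∀ j, τ (y' j : P) = y' j := by
    intro j
    fin_cases j
    · exact (congrArg τ hy'v0).trans ((D4.d4m2_cover_zero_fixed τ z hz d d₂).trans hy'v0.symm)
    · exact (congrArg τ hy'v1).trans ((D4.d4m2_cover_one_fixed τ X₀ ηinv hX₀ hηinv d d₂).trans hy'v1.symm)
  have hc0' : ((coverElement (mapGrading DW.𝒜 Φ) (![z, X₀] : Fin 2 → P) ![1, 1] (d₂ * (d * (2 * p))) (y' 0) (hy' 0) :
      ↥(cobordantAlgebra (![z, X₀] : Fin 2 → P) ![1, 1])) : P[T;T⁻¹]) =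
      LaurentPolynomial.C (z ^ (d₂ * (d * (2 * p)))) * LaurentPolynomial.T (((d₂ * (d * (2 * p)) : ℕ)) : ℤ) :=
    (coe_coverElement (mapGrading DW.𝒜 Φ) (![z, X₀] : Fin 2 → P) ![1, 1] (d₂ * (d * (2 * p))) (y' 0) (hy' 0)).trans
      (congrArg (fun x : P => LaurentPolynomial.C x * LaurentPolynomial.T (((d₂ * (d * (2 * p)) : ℕ)) : ℤ)) hy'v0)
  have hc1' : ((coverElement (mapGrading DW.𝒜 Φ) (![z, X₀] : Fin 2 → P) ![1, 1] (d₂ * (d * (2 * p))) (y' 1) (hy' 1) :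
      ↥(cobordantAlgebra (![z, X₀] : Fin 2 → P) ![1, 1])) : P[T;T⁻¹]) =
      LaurentPolynomial.C ((X₀ ^ (d * p) * ηinv) ^ (2 * d₂)) * LaurentPolynomial.T (((d₂ * (d * (2 * p)) : ℕ)) : ℤ) :=
    (coe_coverElement (mapGrading DW.𝒜 Φ) (![z, X₀] : Fin 2 → P) ![1, 1] (d₂ * (d * (2 * p))) (y' 1) (hy' 1)).trans
      (congrArg (fun x : P => LaurentPolynomial.C x * LaurentPolynomial.T (((d₂ * (d * (2 * p)) : ℕ)) : ℤ)) hy'v1)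
  have hrad' : ∀ i : Fin 2, cobordantAlgebra.u' (![z, X₀] : Fin 2 → P) ![1, 1] i ∈
      (Ideal.span (Set.range fun j => coverElement (mapGrading DW.𝒜 Φ) (![z, X₀] : Fin 2 → P) ![1, 1] (d₂ * (d * (2 * p))) (y' j) (hy' j))).radical := by
    intro i
    have h := D4.d4m2_hrad z X₀ η ηinv hηη d d₂ (coverElement (mapGrading DW.𝒜 Φ) (![z, X₀] : Fin 2 → P) ![1, 1] (d₂ * (d * (2 * p))) (y' 0) (hy' 0))
      (coverElement (mapGrading DW.𝒜 Φ) (![z, X₀] : Fin 2 → P) ![1, 1] (d₂ * (d * (2 * p))) (y' 1) (hy' 1)) hc0' hc1' i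
    refine Ideal.radical_mono (Ideal.span_mono ?_) h
    exact Set.insert_subset_iff.mpr ⟨⟨0, rfl⟩, Set.singleton_subset_iff.mpr ⟨1, rfl⟩⟩
  -- (H1) and the residual ideal `𝔞₂ ∋ X₁ Y₂`
  have hH1 := D4.d4m2_augmentationIdeal_sigmaR_le τ s X₀ X₁ z x₃ Gfix hs hX₀ hX₁ hz hx₃ hfix hgen hp.pos hσp
  obtain ⟨hres1, -⟩ := D4.d4m2_residual_mem τ s X₀ X₁ z x₃ Gfix hs hX₀ hX₁ hz hx₃ hfix hgen hp.pos hσp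
  -- the second cover element lies in `𝔞₂` (`Y = X₀T ∈ 𝔞₂`)
  have hc1mem : coverElement (mapGrading DW.𝒜 Φ) (![z, X₀] : Fin 2 → P) ![1, 1] (d₂ * (d * (2 * p))) (y' 1) (hy' 1) ∈
      (augmentationIdeal (sigmaR τ (![z, X₀] : Fin 2 → P) ![1, 1] hσJ₂ hp.pos hσp)).colon
        (Ideal.span {algebraMap P ↥(cobordantAlgebra (![z, X₀] : Fin 2 → P) ![1, 1]) s * cobordantAlgebra.s (![z, X₀] : Fin 2 → P) ![1, 1]}) := by
    rw [D4.d4m2_coverElement_one_eq z X₀ ηinv d d₂ _ hc1']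
    exact Ideal.mul_mem_right _ _ (Ideal.pow_mem_of_mem _ hres1 _ (Nat.mul_pos hdp (Nat.mul_pos two_pos hd₂)))
  -- the atlas of move 2
  obtain ⟨OW₂, hOW₂aff, hOW₂eq, E₂, htame₂, hE₂, hpin₂, 𝔄₂, hF₂⟩ := exists_moveAtlas_of_node hp.pos hG M₁ M₂ 𝔄₁ W DW.affine
    DW.r (mapGrading DW.𝒜 Φ) (![z, X₀] : Fin 2 → P) ![1, 1] hf₂ τ (DW.e.trans (zeroRingEquiv DW.𝒜 Φ)) htameτ hσp hσL hw' hK1 hK1' hσJ₂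
    𝒦₂ d₂ hG𝒦₂ h𝒦₂O hver₂ hsupp₂ π₂ hbl₂ hr₂ hcomm₂ hdbar y' hy' hσy' hrad'
    (algebraMap P ↥(cobordantAlgebra (![z, X₀] : Fin 2 → P) ![1, 1]) s * cobordantAlgebra.s (![z, X₀] : Fin 2 → P) ![1, 1]) hH1 (fun _ => 1)
    (fun j => ![algebraMap _ (ChartRing (mapGrading DW.𝒜 Φ) (![z, X₀] : Fin 2 → P) ![1, 1] (d₂ * (d * (2 * p))) (y' j) (hy' j))
        (coverElement (mapGrading DW.𝒜 Φ) (![z, X₀] : Fin 2 → P) ![1, 1] (d₂ * (d * (2 * p))) (y' 1) (hy' 1)) *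
      IsLocalization.Away.invSelf (coverElement (mapGrading DW.𝒜 Φ) (![z, X₀] : Fin 2 → P) ![1, 1] (d₂ * (d * (2 * p))) (y' j) (hy' j))])
    (fun j l => by
      fin_cases l
      exact residualSection_mem_chartNodeGrading_zero DW.r (mapGrading DW.𝒜 Φ) (![z, X₀] : Fin 2 → P) ![1, 1] hf₂ (y' j) (hy' j)
        (coverElement_mem_reesPiece (mapGrading DW.𝒜 Φ) (![z, X₀] : Fin 2 → P) ![1, 1] (d₂ * (d * (2 * p))) (y' 1) (hy' 1)))
    (fun j l => by
      fin_cases l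
      exact residualSection_mem_map DW.r (mapGrading DW.𝒜 Φ) (![z, X₀] : Fin 2 → P) ![1, 1] (y' j) (hy' j) hc1mem)
  have hWle : ∀ j, (OW₂ j).1 ≤ π₂ ⁻¹ᵁ W.1 := fun j => by rw [hOW₂eq j]; exact blowupChart_le_preimage π₂ _ ⟨W.1, DW.affine⟩ _
  -- the `N₂` chart is killed: its residual section is `1`
  have hz1W : ∀ v ∈ (OW₂ 1).1, v ∈ M₂.V.basicOpen
      (letI := chartNodeGradedRing DW.r (mapGrading DW.𝒜 Φ) (![z, X₀] : Fin 2 → P) ![1, 1] hf₂ (d₂ * (d * (2 * p))) (y' 1) (hy' 1);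
        (E₂ 1).symm ⟨_, residualSection_mem_chartNodeGrading_zero DW.r (mapGrading DW.𝒜 Φ) (![z, X₀] : Fin 2 → P) ![1, 1] hf₂ (y' 1) (hy' 1)
          (coverElement_mem_reesPiece (mapGrading DW.𝒜 Φ) (![z, X₀] : Fin 2 → P) ![1, 1] (d₂ * (d * (2 * p))) (y' 1) (hy' 1))⟩) := fun v hv => by
    letI := chartNodeGradedRing DW.r (mapGrading DW.𝒜 Φ) (![z, X₀] : Fin 2 → P) ![1, 1] hf₂ (d₂ * (d * (2 * p))) (y' 1) (hy' 1)
    have h1 : (⟨_, residualSection_mem_chartNodeGrading_zero DW.r (mapGrading DW.𝒜 Φ) (![z, X₀] : Fin 2 → P) ![1, 1] hf₂ (y' 1) (hy' 1)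
          (coverElement_mem_reesPiece (mapGrading DW.𝒜 Φ) (![z, X₀] : Fin 2 → P) ![1, 1] (d₂ * (d * (2 * p))) (y' 1) (hy' 1))⟩ :
        ↥((chartNodeGrading DW.r (mapGrading DW.𝒜 Φ) (![z, X₀] : Fin 2 → P) ![1, 1] hf₂ (d₂ * (d * (2 * p))) (y' 1) (hy' 1)) 0)) = 1 :=
      Subtype.ext (IsLocalization.Away.mul_invSelf _)
    rw [h1, map_one, Scheme.basicOpen_of_isUnit _ isUnit_one]
    exact hv
  have hF₂W : 𝔄₂.fLocus ⊆ ((OW₂ 0).1 : Set M₂.V) := by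
    intro v hv
    rcases hF₂ hv with hold | hnew
    · exact absurd (hF₁ hold.1) hold.2
    · obtain ⟨j, hvW, hvR⟩ := Set.mem_iUnion.mp hnew
      revert hvW hvR
      refine Fin.cases ?_ (fun j' => Fin.cases ?_ (fun j'' => j''.elim0) j') j
      · intro hvW _
        exact hvW
      · intro hvW hvR
        exact absurd (hz1W v hvW) (hvR 0)
  -- ### the exposed node of `W₂ = OW₂ 0`: cover of `M₂.V` and the ratio section
  have hπ' : IsBlowup π₂ ((𝒦₂.ideal d₂) ^ (d * (2 * p))) := isBlowup_pow hbl₂ hdbar.ne'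
  have hverbar := CoarseChart.veroneseNormalised_mul (mapGrading DW.𝒜 Φ) _ _ hver₂ hdbar
  have hJ' : ((𝒦₂.ideal d₂) ^ (d * (2 * p))).ideal ⟨W.1, DW.affine⟩ =
      ((traceFiltration (mapGrading DW.𝒜 Φ) (![z, X₀] : Fin 2 → P) ![1, 1]).ideal (d₂ * (d * (2 * p)))).comap
        ((DW.e.trans (zeroRingEquiv DW.𝒜 Φ) : Γ(M₁.V, W.1) ≃+* ↥(mapGrading DW.𝒜 Φ 0)) : Γ(M₁.V, W.1) →+* ↥(mapGrading DW.𝒜 Φ 0)) := by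
    rw [Scheme.IdealSheafData.ideal_pow, Pi.pow_apply, ← ReesFiltration.filtration_ideal, h𝒦₂O d₂, hver₂.2 (d * (2 * p)), comap_equiv_pow]
  have hxJ0 : (DW.e.trans (zeroRingEquiv DW.𝒜 Φ)).symm (y' 0) ∈ ((𝒦₂.ideal d₂) ^ (d * (2 * p))).ideal ⟨W.1, DW.affine⟩ := by
    rw [hJ', Ideal.mem_comap, RingHom.coe_coe, RingEquiv.apply_symm_apply]; exact hy' 0
  have hcov₂ : ∀ x : M₂.V, x ∈ (OW₂ 0).1 ∨ x ∈ (OW₂ 1).1 ∨ ∃ i, π₂.base x ∈ U i := by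
    intro x
    rcases hcov (π₂.base x) with hxW | hxU
    · have hcovW := iSup_blowupChart_eq_preimage (I := 𝒦₂.ideal d₂) M₁.act DW.r (mapGrading DW.𝒜 Φ) (![z, X₀] : Fin 2 → P) ![1, 1] hf₂
        W DW.affine (DW.e.trans (zeroRingEquiv DW.𝒜 Φ)) hπ' hverbar hJ' y' hy' hrad'
      have hx : x ∈ ⨆ j, blowupChart π₂ ((𝒦₂.ideal d₂) ^ (d * (2 * p))) ⟨W.1, DW.affine⟩ ((DW.e.trans (zeroRingEquiv DW.𝒜 Φ)).symm (y' j)) :=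
        (congrArg (fun U : M₂.V.Opens => x ∈ U) hcovW).mpr hxW
      obtain ⟨j, hj⟩ := Opens.mem_iSup.mp hx
      revert hj
      refine Fin.cases ?_ (fun j' => Fin.cases ?_ (fun j'' => j''.elim0) j') j
      · intro hj; exact Or.inl ((congrArg (fun U : M₂.V.Opens => x ∈ U) (hOW₂eq 0)).mpr hj)
      · intro hj; exact Or.inr (Or.inl ((congrArg (fun U : M₂.V.Opens => x ∈ U) (hOW₂eq 1)).mpr hj))
    · exact Or.inr (Or.inr hxU)
  -- the ratio section `u₂ = E₂⁻¹(c₁/c₀)` on `W₂` and its pin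
  letI inst0 := chartNodeGradedRing DW.r (mapGrading DW.𝒜 Φ) (![z, X₀] : Fin 2 → P) ![1, 1] hf₂ (d₂ * (d * (2 * p))) (y' 0) (hy' 0)
  have hz0mem := residualSection_mem_chartNodeGrading_zero DW.r (mapGrading DW.𝒜 Φ) (![z, X₀] : Fin 2 → P) ![1, 1] hf₂ (y' 0) (hy' 0)
    (coverElement_mem_reesPiece (mapGrading DW.𝒜 Φ) (![z, X₀] : Fin 2 → P) ![1, 1] (d₂ * (d * (2 * p))) (y' 1) (hy' 1))
  have hpz : (E₂ 0).symm ⟨_, hz0mem⟩ * π₂.appLE W.1 (OW₂ 0).1 (hWle 0) ((DW.e.trans (zeroRingEquiv DW.𝒜 Φ)).symm (y' 0)) =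
      π₂.appLE W.1 (OW₂ 0).1 (hWle 0) ((DW.e.trans (zeroRingEquiv DW.𝒜 Φ)).symm (y' 1)) :=
    symm_mul_appLE_eq_of_pin π₂ W.1 (OW₂ 0).1 (hWle 0)
      (chartNodeGrading DW.r (mapGrading DW.𝒜 Φ) (![z, X₀] : Fin 2 → P) ![1, 1] hf₂ (d₂ * (d * (2 * p))) (y' 0) (hy' 0)) (E₂ 0)
      (DW.e.trans (zeroRingEquiv DW.𝒜 Φ)) (toChartRing (mapGrading DW.𝒜 Φ) (![z, X₀] : Fin 2 → P) ![1, 1] (d₂ * (d * (2 * p))) (y' 0) (hy' 0))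
      (hpin₂ 0 (hWle 0)) ⟨_, hz0mem⟩ _ _ (y' 1) (y' 0) (RingEquiv.apply_symm_apply _ _) (RingEquiv.apply_symm_apply _ _)
      (coverRatio_mul_toChartRing (mapGrading DW.𝒜 Φ) (![z, X₀] : Fin 2 → P) ![1, 1] (d₂ * (d * (2 * p))) (y' 0) (y' 1) (hy' 0) (hy' 1))
  have hu₂ : ∀ v ∈ (OW₂ 0).1, v ∈ (OW₂ 1).1 → v ∈ M₂.V.basicOpen ((E₂ 0).symm ⟨_, hz0mem⟩) := fun v hv0 hv1 =>
    mem_basicOpen_of_mem_blowupChart_of_mul_appLE_eq hπ' ⟨W.1, DW.affine⟩ hxJ0 (le_of_eq (hOW₂eq 0)) _ hpz hv0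
      ((congrArg (fun U : M₂.V.Opens => v ∈ U) (hOW₂eq 1)).mp hv1)
  refine ⟨OW₂ 0, 𝔄₂, hF₂W, hOW₂aff 0, hWle 0, hf₂, hσJ₂, hσp, y' 0, hy'v0, hy' 0, hσy' 0,
    coverElement (mapGrading DW.𝒜 Φ) (![z, X₀] : Fin 2 → P) ![1, 1] (d₂ * (d * (2 * p))) (y' 1) (hy' 1), hc1', E₂ 0, (OW₂ 1).1,
    (E₂ 0).symm ⟨_, hz0mem⟩, htame₂ 0, hE₂ 0, hpin₂ 0 (hWle 0), hcov₂, ?_, hu₂⟩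
  rw [(E₂ 0).apply_symm_apply]

end Summit.ResolutionOfSingularities.ResolutionOfSingularities.Theorems.WildQuotientResolution.S1.GameFrame.GModel

end
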